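import Summits.ValiantsHypothesis.ValiantsHypothesis.Theorems.PolyaContinuedMonotoneCoverHardWidthCut

/-!
# Crux `MonotoneCoverHard` (stmt-ValiantsHypothesis-7421): WIDTH PROFILES are matching-independent, a
balanced level exists unless a level is fat, and the crux HOLDS for levelled covers of width `≤ 2`

Second rung of the WIDTH reformulation (val-width-7421-p2 g0, 2026-08-27; sequel of
`…WidthCut.lean`).  For a cover `(m, E, a)` of `per_n` (labels in `{X j, 0, 1}`, `per_n = aeval a PM_E`)
with a LEVEL FUNCTION `g` (`hvar`, `hone`), write `F_ℓ(τ)` for the number of variable edges of a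
weight-nonzero perfect matching `τ` whose row endpoint has level `ℓ`, and `P_h(τ) = Σ_{ℓ<h} F_ℓ(τ)`.

* `card_cols_level_eq` / `varCount_add_cols_eq` — double counting of the level-`ℓ` columns:
  `F_ℓ(τ) + |C_ℓ| = |R_ℓ| + F_{ℓ-1}(τ)` (and `F_0(τ) + |C_0| = |R_0|`);
* `varCount_eq` / `belowCount_eq` — **WIDTH PROFILE INVARIANCE**: `F_ℓ(τ) = F_ℓ(τ')` and
  `P_h(τ) = P_h(τ')` for all weight-nonzero `τ, τ'` — every cover with a level function is a generalised
  ABP whose level transition `ℓ → ℓ+1` carries the SAME number `c_ℓ` of variable edges of every matching;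
* `card_var_eq_n` — every weight-nonzero matching has exactly `n` variable edges (label bijection, p1);
* `exists_balanced_level` — **DICHOTOMY**: if no level is fat (`3 c_ℓ ≤ n` for all `ℓ`) and `1 ≤ n`, some
  level `h ≥ 1` is balanced (`n ≤ 3 P_h ≤ 2n`);
* `two_pow_le_pow_four_of_width_le_two` — **RUNG**: a label-bijective Pfaffian cover of `per_n`, `n ≥ 7`,
  levelled with all widths `c_ℓ ≤ 2` has `2^(n/3) ≤ m^4` (via `two_pow_le_pow_width`);
* `no_quasipolynomial_width_two_cover` — hence **`MonotoneCoverHard` for levelled covers of width `≤ 2`**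
  (the crux statement with that conjunct inside the purported family) — one rung above the graded
  (`c_ℓ = 1`, ABP) class of `…GradedLowerBound.lean`; `K_{2,2}`-block covers live here.

Not done here: the existence of a level function for EVERY label-bijective cover (true — alternating
cycles span the circulation space of an elementary bipartite graph — but its kernel proof needs Hetyei's
ear-decomposition theorem); the general WIDTH bet.  VP ≠ VNP is not moved.  No definitions.
-/

namespace Summit.ValiantsHypothesis.ValiantsHypothesis.Theorems.PolyaContinuedMonotoneCoverHard

-- summit = sub-problem name (single-conjunct summit, D-0017 layout), so the namespace repeats it
set_option linter.dupNamespace false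

open scoped Classical
open Finset
open Summit.ValiantsHypothesis.ValiantsHypothesis.Theorems.PolyaContinued.MonotoneCoverHardRectangle
  (exists_labels aeval_permanent_cover perPoly_eq_sum_monomial label_bijection pexp_injective
    degree_pexp)

section Profile

variable {m n : ℕ} (E : Finset (Fin m × Fin m)) (a : Fin m × Fin m → MvPolynomial (Fin n × Fin n) ℂ)
  (g : Fin m ⊕ Fin m → ℕ)
  (hvar : ∀ i j, (i, j) ∈ E → (∃ k, a (i, j) = MvPolynomial.X k) →
    g (Sum.inr j) = g (Sum.inl i) + 1)
  (hone : ∀ i j, (i, j) ∈ E → a (i, j) ≠ 0 → (¬ ∃ k, a (i, j) = MvPolynomial.X k) →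
    g (Sum.inr j) = g (Sum.inl i))

include hvar hone in
/-- Double counting of the columns of level `ℓ` along a weight-nonzero perfect matching `τ`: they are
entered either horizontally from a level-`ℓ` row (non-variable edge) or from a level-`(ℓ-1)` row by a
variable edge. -/
theorem card_cols_level_eq (τ : Equiv.Perm (Fin m)) (hτ : ∀ i, (i, τ i) ∈ E ∧ a (i, τ i) ≠ 0)
    (ℓ : ℕ) :
    (univ.filter fun j : Fin m => g (Sum.inr j) = ℓ).card =
      (univ.filter fun i : Fin m =>
          (¬ ∃ k, a (i, τ i) = MvPolynomial.X k) ∧ g (Sum.inl i) = ℓ).card +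
        (univ.filter fun i : Fin m =>
          (∃ k, a (i, τ i) = MvPolynomial.X k) ∧ g (Sum.inl i) + 1 = ℓ).card := by
  have h1 : (univ.filter fun j : Fin m => g (Sum.inr j) = ℓ).card =
      (univ.filter fun i : Fin m => g (Sum.inr (τ i)) = ℓ).card := by
    refine (Finset.card_bij (fun i _ => τ i) (fun i hi => ?_) (fun i _ i' _ h => τ.injective h)
      (fun j hj => ⟨τ.symm j, by simpa using hj, by simp⟩)).symm
    simpa using hi
  rw [h1, ← Finset.card_union_of_disjoint]
  · congr 1
    ext i
    simp only [mem_filter, mem_univ, true_and, mem_union]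
    by_cases hv : ∃ k, a (i, τ i) = MvPolynomial.X k
    · have := hvar i (τ i) (hτ i).1 hv
      constructor
      · intro h; exact Or.inr ⟨hv, by omega⟩
      · rintro (⟨h, -⟩ | ⟨-, h⟩)
        · exact absurd hv h
        · omega
    · have := hone i (τ i) (hτ i).1 (hτ i).2 hv
      constructor
      · intro h; exact Or.inl ⟨hv, by omega⟩
      · rintro (⟨-, h⟩ | ⟨h, -⟩)
        · omega
        · exact absurd h hv
  · exact Finset.disjoint_filter.2 fun i _ h1 h2 => h1.1 h2.1

include hvar hone in
/-- `F_ℓ(τ) + |C_ℓ| = |R_ℓ| + F'_ℓ(τ)` where `F'_ℓ(τ)` counts the variable edges of `τ` whose row level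
is `ℓ - 1` (written as `g + 1 = ℓ`, so that `F'_0 = 0`). -/
theorem varCount_add_cols_eq (τ : Equiv.Perm (Fin m)) (hτ : ∀ i, (i, τ i) ∈ E ∧ a (i, τ i) ≠ 0)
    (ℓ : ℕ) :
    (univ.filter fun i : Fin m => (∃ k, a (i, τ i) = MvPolynomial.X k) ∧ g (Sum.inl i) = ℓ).card +
        (univ.filter fun j : Fin m => g (Sum.inr j) = ℓ).card =
      (univ.filter fun i : Fin m => g (Sum.inl i) = ℓ).card +
        (univ.filter fun i : Fin m =>
          (∃ k, a (i, τ i) = MvPolynomial.X k) ∧ g (Sum.inl i) + 1 = ℓ).card := by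
  rw [card_cols_level_eq E a g hvar hone τ hτ ℓ, ← add_assoc]
  congr 1
  rw [← Finset.card_union_of_disjoint]
  · congr 1
    ext i
    simp only [mem_filter, mem_univ, true_and, mem_union]
    tauto
  · exact Finset.disjoint_filter.2 fun i _ h1 h2 => h2.1 h1.1

include hvar hone in
/-- **Width profile invariance.**  Two weight-nonzero perfect matchings of a levelled cover have the same
number of variable edges leaving each row level. -/
theorem varCount_eq (τ τ' : Equiv.Perm (Fin m)) (hτ : ∀ i, (i, τ i) ∈ E ∧ a (i, τ i) ≠ 0)
    (hτ' : ∀ i, (i, τ' i) ∈ E ∧ a (i, τ' i) ≠ 0) (ℓ : ℕ) :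
    (univ.filter fun i : Fin m => (∃ k, a (i, τ i) = MvPolynomial.X k) ∧ g (Sum.inl i) = ℓ).card =
      (univ.filter fun i : Fin m =>
        (∃ k, a (i, τ' i) = MvPolynomial.X k) ∧ g (Sum.inl i) = ℓ).card := by
  induction ℓ using Nat.strong_induction_on with
  | _ ℓ ih =>
    have h1 := varCount_add_cols_eq E a g hvar hone τ hτ ℓ
    have h2 := varCount_add_cols_eq E a g hvar hone τ' hτ' ℓ
    -- the shifted counts agree: level `ℓ - 1 < ℓ`, or empty when `ℓ = 0`
    have h3 : (univ.filter fun i : Fin m =>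
          (∃ k, a (i, τ i) = MvPolynomial.X k) ∧ g (Sum.inl i) + 1 = ℓ).card =
        (univ.filter fun i : Fin m =>
          (∃ k, a (i, τ' i) = MvPolynomial.X k) ∧ g (Sum.inl i) + 1 = ℓ).card := by
      rcases Nat.eq_zero_or_pos ℓ with h0 | h0
      · subst h0
        rw [Finset.card_eq_zero.2, Finset.card_eq_zero.2] <;>
          exact Finset.filter_eq_empty_iff.2 fun i _ h => by omega
      · have e1 : ∀ σ : Equiv.Perm (Fin m), (univ.filter fun i : Fin m =>
            (∃ k, a (i, σ i) = MvPolynomial.X k) ∧ g (Sum.inl i) + 1 = ℓ) =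
            univ.filter fun i : Fin m =>
              (∃ k, a (i, σ i) = MvPolynomial.X k) ∧ g (Sum.inl i) = ℓ - 1 := by
          intro σ
          exact Finset.filter_congr fun i _ => by
            constructor
            · rintro ⟨hv, h⟩; exact ⟨hv, by omega⟩
            · rintro ⟨hv, h⟩; exact ⟨hv, by omega⟩
        rw [e1 τ, e1 τ', ih (ℓ - 1) (by omega)]
    omega

include hvar hone in
/-- Invariance of the below-level counts `P_h(τ) = #{variable edges of τ with row level < h}`. -/
theorem belowCount_eq (τ τ' : Equiv.Perm (Fin m)) (hτ : ∀ i, (i, τ i) ∈ E ∧ a (i, τ i) ≠ 0)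
    (hτ' : ∀ i, (i, τ' i) ∈ E ∧ a (i, τ' i) ≠ 0) (h : ℕ) :
    (univ.filter fun i : Fin m => (∃ k, a (i, τ i) = MvPolynomial.X k) ∧ g (Sum.inl i) < h).card =
      (univ.filter fun i : Fin m =>
        (∃ k, a (i, τ' i) = MvPolynomial.X k) ∧ g (Sum.inl i) < h).card := by
  induction h with
  | zero => simp
  | succ h ih =>
    have split : ∀ σ : Equiv.Perm (Fin m), (univ.filter fun i : Fin m =>
        (∃ k, a (i, σ i) = MvPolynomial.X k) ∧ g (Sum.inl i) < h + 1).card =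
        (univ.filter fun i : Fin m =>
          (∃ k, a (i, σ i) = MvPolynomial.X k) ∧ g (Sum.inl i) < h).card +
        (univ.filter fun i : Fin m =>
          (∃ k, a (i, σ i) = MvPolynomial.X k) ∧ g (Sum.inl i) = h).card := by
      intro σ
      rw [← Finset.card_union_of_disjoint]
      · congr 1
        ext i
        simp only [mem_filter, mem_univ, true_and, mem_union]
        constructor
        · rintro ⟨hv, hl⟩
          rcases Nat.lt_succ_iff_lt_or_eq.1 hl with hl | hl
          · exact Or.inl ⟨hv, hl⟩
          · exact Or.inr ⟨hv, hl⟩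
        · rintro (⟨hv, hl⟩ | ⟨hv, hl⟩) <;> exact ⟨hv, by omega⟩
      · exact Finset.disjoint_filter.2 fun i _ h1 h2 => by omega
    rw [split τ, split τ', ih, varCount_eq E a g hvar hone τ τ' hτ hτ' h]

end Profile

/-- Every weight-nonzero perfect matching of a cover of `per_n` has exactly `n` variable edges (its label
exponent is a permutation exponent, of degree `n`; p1's `label_bijection`). -/
theorem card_var_eq_n {m n : ℕ} (E : Finset (Fin m × Fin m))
    (a : Fin m × Fin m → MvPolynomial (Fin n × Fin n) ℂ)
    (ha : ∀ e, (∃ j, a e = MvPolynomial.X j) ∨ a e = 0 ∨ a e = 1)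
    (hper : Literature.Computability.AlgebraicComplexity.perPoly (Fin n) ℂ =
      MvPolynomial.aeval a (Matrix.of fun i j => if (i, j) ∈ E then MvPolynomial.X (i, j) else 0 :
          Matrix (Fin m) (Fin m) (MvPolynomial (Fin m × Fin m) ℂ)).permanent)
    (τ : Equiv.Perm (Fin m)) (hτ : ∀ i, (i, τ i) ∈ E ∧ a (i, τ i) ≠ 0) :
    (univ.filter fun i : Fin m => ∃ k, a (i, τ i) = MvPolynomial.X k).card = n := by
  obtain ⟨δ, hδ, hδ1, hδ0⟩ := exists_labels a ha
  set G := Finset.univ.filter fun τ : Equiv.Perm (Fin m) => ∀ i, (i, τ i) ∈ E ∧ a (i, τ i) ≠ 0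
    with hG
  have hsum : ∑ τ ∈ G, MvPolynomial.monomial (∑ i, δ (i, τ i)) (1 : ℂ) =
      ∑ σ : Equiv.Perm (Fin n), MvPolynomial.monomial (∑ k, Finsupp.single (k, σ k) 1) (1 : ℂ) := by
    rw [← aeval_permanent_cover E a δ hδ G hG, ← hper, perPoly_eq_sum_monomial]
  obtain ⟨-, himg, -⟩ := label_bijection G (fun τ => ∑ i, δ (i, τ i))
    (fun σ : Equiv.Perm (Fin n) => ∑ k, Finsupp.single (k, σ k) (1 : ℕ)) pexp_injective hsum
  obtain ⟨σ, hσ⟩ := himg τ (by rw [hG]; exact Finset.mem_filter.2 ⟨Finset.mem_univ _, hτ⟩)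
  have hdeg := congrArg Finsupp.degree hσ
  rw [degree_pexp, map_sum] at hdeg
  have hterm : ∀ i, Finsupp.degree (δ (i, τ i)) =
      if (∃ k, a (i, τ i) = MvPolynomial.X k) then 1 else 0 := by
    intro i
    split_ifs with h
    · exact hδ1 _ h
    · rw [hδ0 _ h, map_zero]
  have hsum2 : (∑ i, Finsupp.degree (δ (i, τ i))) =
      (univ.filter fun i : Fin m => ∃ k, a (i, τ i) = MvPolynomial.X k).card := by
    simp_rw [hterm]
    rw [Finset.sum_boole, Nat.cast_id]
  calc _ = ∑ i, Finsupp.degree (δ (i, τ i)) := hsum2.symm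
    _ = n := hdeg

/-- **Dichotomy: a balanced level exists unless a level is fat.**  For a weight-nonzero perfect matching
`τ` with `n ≥ 1` variable edges in total, if every row level carries at most `n/3` of them
(`3 F_ℓ(τ) ≤ n`), then some level `h ≥ 1` has between `n/3` and `2n/3` variable edges of `τ` strictly
below it. -/
theorem exists_balanced_level {m n : ℕ} (a : Fin m × Fin m → MvPolynomial (Fin n × Fin n) ℂ)
    (g : Fin m ⊕ Fin m → ℕ) (τ : Equiv.Perm (Fin m)) (hn : 1 ≤ n)
    (htot : (univ.filter fun i : Fin m => ∃ k, a (i, τ i) = MvPolynomial.X k).card = n)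
    (hfat : ∀ ℓ, 3 * (univ.filter fun i : Fin m =>
      (∃ k, a (i, τ i) = MvPolynomial.X k) ∧ g (Sum.inl i) = ℓ).card ≤ n) :
    ∃ h, 1 ≤ h ∧
      n ≤ 3 * (univ.filter fun i : Fin m =>
          (∃ k, a (i, τ i) = MvPolynomial.X k) ∧ g (Sum.inl i) < h).card ∧
      3 * (univ.filter fun i : Fin m =>
          (∃ k, a (i, τ i) = MvPolynomial.X k) ∧ g (Sum.inl i) < h).card ≤ 2 * n := by
  -- notation-free helpers
  have split : ∀ h, (univ.filter fun i : Fin m =>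
      (∃ k, a (i, τ i) = MvPolynomial.X k) ∧ g (Sum.inl i) < h + 1).card =
      (univ.filter fun i : Fin m =>
        (∃ k, a (i, τ i) = MvPolynomial.X k) ∧ g (Sum.inl i) < h).card +
      (univ.filter fun i : Fin m =>
        (∃ k, a (i, τ i) = MvPolynomial.X k) ∧ g (Sum.inl i) = h).card := by
    intro h
    rw [← Finset.card_union_of_disjoint]
    · congr 1
      ext i
      simp only [mem_filter, mem_univ, true_and, mem_union]
      constructor
      · rintro ⟨hv, hl⟩
        rcases Nat.lt_succ_iff_lt_or_eq.1 hl with hl | hl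
        · exact Or.inl ⟨hv, hl⟩
        · exact Or.inr ⟨hv, hl⟩
      · rintro (⟨hv, hl⟩ | ⟨hv, hl⟩) <;> exact ⟨hv, by omega⟩
    · exact Finset.disjoint_filter.2 fun i _ h1 h2 => by omega
  -- above the top level everything is counted
  set H := (univ : Finset (Fin m)).sup (fun i => g (Sum.inl i)) + 1 with hH
  have hfilt : (univ.filter fun i : Fin m =>
      (∃ k, a (i, τ i) = MvPolynomial.X k) ∧ g (Sum.inl i) < H) =
      univ.filter fun i : Fin m => ∃ k, a (i, τ i) = MvPolynomial.X k := by
    refine Finset.filter_congr fun i _ => ⟨fun h => h.1, fun h => ⟨h, ?_⟩⟩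
    have : g (Sum.inl i) ≤ (univ : Finset (Fin m)).sup (fun i => g (Sum.inl i)) :=
      Finset.le_sup (f := fun i => g (Sum.inl i)) (Finset.mem_univ i)
    omega
  have htop : (univ.filter fun i : Fin m =>
      (∃ k, a (i, τ i) = MvPolynomial.X k) ∧ g (Sum.inl i) < H).card = n := by
    rw [hfilt]; exact htot
  have hex : ∃ h, n ≤ 3 * (univ.filter fun i : Fin m =>
      (∃ k, a (i, τ i) = MvPolynomial.X k) ∧ g (Sum.inl i) < h).card := ⟨H, by rw [htop]; omega⟩
  refine ⟨Nat.find hex, ?_, Nat.find_spec hex, ?_⟩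
  · by_contra h0
    have h0' : Nat.find hex = 0 := by omega
    have := Nat.find_spec hex
    rw [h0'] at this
    simp at this
    omega
  · obtain ⟨h', hh'⟩ : ∃ h', Nat.find hex = h' + 1 := by
      refine Nat.exists_eq_add_one.2 (Nat.pos_of_ne_zero fun h0 => ?_)
      have := Nat.find_spec hex
      rw [h0] at this
      simp at this
      omega
    have hmin : ¬ n ≤ 3 * (univ.filter fun i : Fin m =>
        (∃ k, a (i, τ i) = MvPolynomial.X k) ∧ g (Sum.inl i) < h').card :=
      Nat.find_min hex (by omega)
    rw [hh', split h']
    have := hfat h'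
    omega

/-- **RUNG (width ≤ 2): `2^(n/3) ≤ m^4`.**  A label-bijective Pfaffian cover of `per_n`, `n ≥ 7`, with a
level function all of whose widths are `≤ 2` (every weight-nonzero perfect matching has at most two
variable edges leaving each row level) has `m^4 ≥ 2^(n/3)`: no level is fat, so a balanced level exists
for one matching (`exists_balanced_level`), hence for all (`belowCount_eq`), its two adjacent widths are
common to all matchings (`varCount_eq`) and sum to `≤ 4`, and `two_pow_le_pow_width` applies. -/
theorem two_pow_le_pow_four_of_width_le_two (n m : ℕ) (hn : 7 ≤ n) (E : Finset (Fin m × Fin m))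
    (a : Fin m × Fin m → MvPolynomial (Fin n × Fin n) ℂ)
    (hsig : ∃ s : Fin m × Fin m → ℂ, (∀ e, s e = 1 ∨ s e = -1) ∧
      (Matrix.of fun i j => if (i, j) ∈ E then MvPolynomial.C (s (i, j)) * MvPolynomial.X (i, j)
          else 0 : Matrix (Fin m) (Fin m) (MvPolynomial (Fin m × Fin m) ℂ)).det =
        (Matrix.of fun i j => if (i, j) ∈ E then MvPolynomial.X (i, j) else 0 :
          Matrix (Fin m) (Fin m) (MvPolynomial (Fin m × Fin m) ℂ)).permanent)
    (ha : ∀ e, (∃ j, a e = MvPolynomial.X j) ∨ a e = 0 ∨ a e = 1)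
    (hper : Literature.Computability.AlgebraicComplexity.perPoly (Fin n) ℂ =
      MvPolynomial.aeval a (Matrix.of fun i j => if (i, j) ∈ E then MvPolynomial.X (i, j) else 0 :
          Matrix (Fin m) (Fin m) (MvPolynomial (Fin m × Fin m) ℂ)).permanent)
    (g : Fin m ⊕ Fin m → ℕ)
    (hvar : ∀ i j, (i, j) ∈ E → (∃ k, a (i, j) = MvPolynomial.X k) →
      g (Sum.inr j) = g (Sum.inl i) + 1)
    (hone : ∀ i j, (i, j) ∈ E → a (i, j) ≠ 0 → (¬ ∃ k, a (i, j) = MvPolynomial.X k) →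
      g (Sum.inr j) = g (Sum.inl i))
    (hwidth : ∀ τ : Equiv.Perm (Fin m), (∀ i, (i, τ i) ∈ E ∧ a (i, τ i) ≠ 0) → ∀ ℓ,
      (univ.filter fun i : Fin m =>
        (∃ k, a (i, τ i) = MvPolynomial.X k) ∧ g (Sum.inl i) = ℓ).card ≤ 2) :
    2 ^ (n / 3) ≤ m ^ 4 := by
  -- a weight-nonzero perfect matching exists (the cover realises the identity permutation)
  obtain ⟨δ, hδ, -, -⟩ := exists_labels a ha
  set G := Finset.univ.filter fun τ : Equiv.Perm (Fin m) => ∀ i, (i, τ i) ∈ E ∧ a (i, τ i) ≠ 0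
    with hG
  have hsum : ∑ τ ∈ G, MvPolynomial.monomial (∑ i, δ (i, τ i)) (1 : ℂ) =
      ∑ σ : Equiv.Perm (Fin n), MvPolynomial.monomial (∑ k, Finsupp.single (k, σ k) 1) (1 : ℂ) := by
    rw [← aeval_permanent_cover E a δ hδ G hG, ← hper, perPoly_eq_sum_monomial]
  obtain ⟨-, -, hsurj⟩ := label_bijection G (fun τ => ∑ i, δ (i, τ i))
    (fun σ : Equiv.Perm (Fin n) => ∑ k, Finsupp.single (k, σ k) (1 : ℕ)) pexp_injective hsum
  obtain ⟨τ₀, hτ₀G, -⟩ := hsurj 1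
  have hτ₀ : ∀ i, (i, τ₀ i) ∈ E ∧ a (i, τ₀ i) ≠ 0 := by
    rw [hG] at hτ₀G; exact (Finset.mem_filter.1 hτ₀G).2
  -- balanced level for `τ₀`
  have htot := card_var_eq_n E a ha hper τ₀ hτ₀
  obtain ⟨h, h1, hlo, hhi⟩ := exists_balanced_level a g τ₀ (by omega) htot
    (fun ℓ => by have := hwidth τ₀ hτ₀ ℓ; omega)
  -- transfer to all matchings and apply the width rung
  have hlow := two_pow_le_pow_width n m E a hsig ha hper g h
    ((univ.filter fun i : Fin m =>
      (∃ k, a (i, τ₀ i) = MvPolynomial.X k) ∧ g (Sum.inl i) = h).card)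
    ((univ.filter fun i : Fin m =>
      (∃ k, a (i, τ₀ i) = MvPolynomial.X k) ∧ g (Sum.inl i) = h - 1).card)
    h1 hvar hone
    (fun τ hτ => by rw [belowCount_eq E a g hvar hone τ τ₀ hτ hτ₀ h]; exact ⟨hlo, hhi⟩)
    (fun τ hτ => varCount_eq E a g hvar hone τ τ₀ hτ hτ₀ h)
    (fun τ hτ => varCount_eq E a g hvar hone τ τ₀ hτ hτ₀ (h - 1))
  have h4 : (univ.filter fun i : Fin m =>
        (∃ k, a (i, τ₀ i) = MvPolynomial.X k) ∧ g (Sum.inl i) = h).card +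
      (univ.filter fun i : Fin m =>
        (∃ k, a (i, τ₀ i) = MvPolynomial.X k) ∧ g (Sum.inl i) = h - 1).card ≤ 4 := by
    have := hwidth τ₀ hτ₀ h; have := hwidth τ₀ hτ₀ (h - 1); omega
  rcases Nat.eq_zero_or_pos m with hm0 | hm0
  · -- no cover of `per_n`, `n ≥ 1`, on `0 + 0` vertices: `τ₀` would have `n` variable edges in `Fin 0`
    exfalso
    subst hm0
    have : (univ.filter fun i : Fin 0 => ∃ k, a (i, τ₀ i) = MvPolynomial.X k).card = 0 := by simp
    omega
  · exact hlow.trans (Nat.pow_le_pow_right hm0 h4)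

/-- `polylog < linear`: `12 (t + c)^c + 3 ≤ 2^t` at `t = 4(c+2)² + 8(c+2) + 4`. -/
theorem twelve_mul_pow_add_three_le_two_pow (c : ℕ) :
    12 * (4 * (c + 2) * (c + 2) + 8 * (c + 2) + 4 + c) ^ c + 3 ≤
      2 ^ (4 * (c + 2) * (c + 2) + 8 * (c + 2) + 4) := by
  have h := six_mul_pow_add_three_le_two_pow (c + 1)
  set t := 4 * (c + 1 + 1) * (c + 1 + 1) + 8 * (c + 1 + 1) + 4 with ht
  -- 12 (t + c)^c ≤ 6 (t + (c+1))^(c+1)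
  have h2 : 2 * (t + c) ^ c ≤ (t + (c + 1)) ^ (c + 1) := by
    rw [pow_succ]
    have h3 : (t + c) ^ c ≤ (t + (c + 1)) ^ c := Nat.pow_le_pow_left (by omega) c
    have h4 : 2 ≤ t + (c + 1) := by omega
    calc 2 * (t + c) ^ c = (t + c) ^ c * 2 := mul_comm _ _
      _ ≤ (t + (c + 1)) ^ c * (t + (c + 1)) := Nat.mul_le_mul h3 h4
  omega

/-- **No quasi-polynomial family of label-bijective Pfaffian covers of the permanent that are levelled
with all widths `≤ 2`.**  The crux `MonotoneCoverHard` with the conjunct "∃ level function `g` with at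
most two variable edges of every weight-nonzero perfect matching leaving each row level" added inside
the purported family — one rung above the graded (ABP) class (`no_quasipolynomial_graded_cover`). -/
theorem no_quasipolynomial_width_two_cover :
    ¬ ∃ c : ℕ, ∀ n : ℕ, ∃ m : ℕ, m ≤ 2 ^ ((Nat.log 2 n + c) ^ c) ∧
      ∃ (E : Finset (Fin m × Fin m)) (a : Fin m × Fin m → MvPolynomial (Fin n × Fin n) ℂ),
        (∃ s : Fin m × Fin m → ℂ, (∀ e, s e = 1 ∨ s e = -1) ∧
          (Matrix.of fun i j => if (i, j) ∈ E then MvPolynomial.C (s (i, j)) * MvPolynomial.X (i, j)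
              else 0 : Matrix (Fin m) (Fin m) (MvPolynomial (Fin m × Fin m) ℂ)).det =
            (Matrix.of fun i j => if (i, j) ∈ E then MvPolynomial.X (i, j) else 0 :
              Matrix (Fin m) (Fin m) (MvPolynomial (Fin m × Fin m) ℂ)).permanent) ∧
        (∀ e, (∃ j, a e = MvPolynomial.X j) ∨ a e = 0 ∨ a e = 1) ∧
        Literature.Computability.AlgebraicComplexity.perPoly (Fin n) ℂ =
          MvPolynomial.aeval a (Matrix.of fun i j => if (i, j) ∈ E then MvPolynomial.X (i, j) else 0 :
              Matrix (Fin m) (Fin m) (MvPolynomial (Fin m × Fin m) ℂ)).permanent ∧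
        ∃ g : Fin m ⊕ Fin m → ℕ,
          (∀ i j, (i, j) ∈ E → (∃ k, a (i, j) = MvPolynomial.X k) →
            g (Sum.inr j) = g (Sum.inl i) + 1) ∧
          (∀ i j, (i, j) ∈ E → a (i, j) ≠ 0 → (¬ ∃ k, a (i, j) = MvPolynomial.X k) →
            g (Sum.inr j) = g (Sum.inl i)) ∧
          (∀ τ : Equiv.Perm (Fin m), (∀ i, (i, τ i) ∈ E ∧ a (i, τ i) ≠ 0) → ∀ ℓ,
            (univ.filter fun i : Fin m =>
              (∃ k, a (i, τ i) = MvPolynomial.X k) ∧ g (Sum.inl i) = ℓ).card ≤ 2) := by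
  rintro ⟨c, hc⟩
  set t := 4 * (c + 2) * (c + 2) + 8 * (c + 2) + 4 with ht
  obtain ⟨m, hm, E, a, hsig, ha, hper, g, hvar, hone, hwidth⟩ := hc (2 ^ t)
  have ht3 : 3 ≤ t := by rw [ht]; nlinarith
  have hn : 7 ≤ 2 ^ t :=
    le_trans (by norm_num : 7 ≤ 2 ^ 3) (Nat.pow_le_pow_right Nat.two_pos ht3)
  have hlow := two_pow_le_pow_four_of_width_le_two (2 ^ t) m hn E a hsig ha hper g hvar hone hwidth
  have hlogn : Nat.log 2 (2 ^ t) = t := Nat.log_pow Nat.one_lt_two _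
  rw [hlogn] at hm
  have hm4 : m ^ 4 ≤ 2 ^ (4 * (t + c) ^ c) := by
    calc m ^ 4 ≤ (2 ^ ((t + c) ^ c)) ^ 4 := Nat.pow_le_pow_left hm 4
      _ = 2 ^ (4 * (t + c) ^ c) := by rw [← pow_mul, mul_comm]
  have hle : 2 ^ t / 3 ≤ 4 * (t + c) ^ c :=
    (Nat.pow_le_pow_iff_right Nat.one_lt_two).1 (hlow.trans hm4)
  have hlt := twelve_mul_pow_add_three_le_two_pow c
  rw [← ht] at hlt
  omega

end Summit.ValiantsHypothesis.ValiantsHypothesis.Theorems.PolyaContinuedMonotoneCoverHard
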